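import Summits.RiemannHypothesis.RiemannHypothesis.Theorems.TiltedLandingLaw421R3Lens1ToothDichotomyC

/-!
# Law 421 — R3, lens 1: the TOOTH–LIFT DICHOTOMY (ii″)/(iii″) — pole-aware successors of (ii′)/(iii′) (#1297)

Token 147 (director-rh (CA1093)/(CA1097); words `M-TARGET-ii2-WORDS.md` 7316d587; critic W1–W5 l.10055 folded). ONE import (#1297).
The class hypothesis of (ii′)/(iii′), `RVClassC κ₁ T H` on a FIVE/FOUR-pole rest factor, is instantiated on few frames because un-peeled LOW zeros
inside `T`'s half-disc blow up `κ₁`; here the caller peels EVERY zero of `f⁽ʲ⁾` of height `≤ Im T` in the box `|Re z − Re T| ≤ ρ·Im T` (with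
multiplicity) into a conj-closed multiset `Z` (`RestFactorZ`), the explicit poles `T, T̄, b, b̄[, t]` are a SUB-MULTISET of `Z` (so `b = T` demands a
double top and is vacuous, not miscounted), `RVClassC κ₁ T H` (verbatim, #1297) prices only the UNPEELED rest (taller or far zeros), and the signed
first-order datum is the LINK MARGIN `LinkMargin μ f j T` (`S₁(T) ≥ 1/2 + μ`, `H`-free; `μ = 0` is the tree's `linkStartLaw` under `NoTallerToucher`
at a simple top — fed by the CALLER, the arc-sign ladder being outside this file's imports). Conclusions VERBATIM as (ii′). (K) items: the pole-aware
log-derivative split `logDeriv_of_restFactorZ`, margin glue, the two dispatchers (a multiple top is the tree's `RhW08.NewtonDoor.succ_of_multiple`),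
and C6's signed-lift sign lemmas (`PairLift-C6-g46.lean` a46187d1584da925, verbatim). The laws are OPEN, asserted by nothing; RH is not addressed.
-/

noncomputable section

open Complex Set
open scoped ComplexConjugate

namespace RhW08.Lens1ToothNestUmbrella

open RhIdea6.G17.W07C7 RhIdea6.G17.W07C7.Rev6 RhIdea6.G18.W07C8.Law421BirthS RhIdea6.G19.W07C11.Seam
open RhW08.Round1 RhW08.StSwap RhW08.Round2 RhW08.QuadW RhW08.SuccB RhW08.SuccSplit
open RhW08.Lens1Pinning (NoTallerToucher)

/-- POLE-AWARE REST FACTOR: `H` entire, `f⁽ʲ⁾ = Π_{q ∈ Z} (z − q) · H` for a finite conj-closed multiset `Z` of peeled zeros WITH MULTIPLICITY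
(the laws below add the box clause `H ≠ 0` on `|Re z − Re T| ≤ ρ·Im T, |Im z| ≤ Im T`, i.e. `Z` exhausts the zeros of `f⁽ʲ⁾` there). -/
def RestFactorZ (f : ℂ → ℂ) (j : ℕ) (Z : Multiset ℂ) (H : ℂ → ℂ) : Prop :=
  Differentiable ℂ H ∧ (∀ z : ℂ, iteratedDeriv j f z = (Z.map (fun q => z - q)).prod * H z) ∧ Z.map conj = Z

/-- LINK MARGIN `μ` at `T` (signed lift, first order, `H`-free): `S₁(T) := −Im T·Im(f⁽ʲ⁺²⁾(T)/f⁽ʲ⁺¹⁾(T))/2 ≥ 1/2 + μ`. -/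
def LinkMargin (μ : ℝ) (f : ℂ → ℂ) (j : ℕ) (T : ℂ) : Prop :=
  1 / 2 + μ ≤ -(T.im * (iteratedDeriv (j + 2) f T / iteratedDeriv (j + 1) f T).im) / 2

/-- (K) the log-derivative of `Π_{q ∈ Z} (w − q) · H w`: off its zeros it is `Σ_{q ∈ Z} (z − q)⁻¹ + H′/H`. -/
theorem logDeriv_prodLinear_mul (Z : Multiset ℂ) :
    ∀ {H : ℂ → ℂ}, Differentiable ℂ H → ∀ {z : ℂ}, (Z.map (fun q => z - q)).prod * H z ≠ 0 →
      deriv (fun w => (Z.map (fun q => w - q)).prod * H w) z / ((Z.map (fun q => z - q)).prod * H z) =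
        (Z.map (fun q => (z - q)⁻¹)).sum + deriv H z / H z := by
  induction Z using Multiset.induction_on with
  | empty =>
    intro H hH z hz
    simp
  | cons q Z ih =>
    intro H hH z hz
    have hH₁ : Differentiable ℂ (fun w => (w - q) * H w) := (differentiable_id.sub (differentiable_const q)).mul hH
    have hfun : (fun w => ((q ::ₘ Z).map (fun q => w - q)).prod * H w) =
        fun w => (Z.map (fun q => w - q)).prod * ((w - q) * H w) := by
      funext w
      rw [Multiset.map_cons, Multiset.prod_cons]
      ring
    have hz' : (Z.map (fun q' => z - q')).prod * ((z - q) * H z) ≠ 0 := by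
      rw [Multiset.map_cons, Multiset.prod_cons] at hz
      convert hz using 1
      ring
    obtain ⟨hP, hqH⟩ := mul_ne_zero_iff.mp hz'
    obtain ⟨hzq, hHz⟩ := mul_ne_zero_iff.mp hqH
    have hval : ((q ::ₘ Z).map (fun q => z - q)).prod * H z = (Z.map (fun q' => z - q')).prod * ((z - q) * H z) := by
      rw [Multiset.map_cons, Multiset.prod_cons]; ring
    rw [hfun, hval, ih hH₁ hz', Multiset.map_cons, Multiset.sum_cons]
    have hd : deriv (fun w => (w - q) * H w) z = 1 * H z + (z - q) * deriv H z :=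
      (((hasDerivAt_id' z).sub_const q).mul (hH z).hasDerivAt).deriv
    rw [hd]
    field_simp
    ring

/-- (K) POLE-AWARE SPLIT: under `RestFactorZ f j Z H`, off the zeros of `f⁽ʲ⁾`, `f⁽ʲ⁺¹⁾/f⁽ʲ⁾ = Σ_{q ∈ Z} (z − q)⁻¹ + H′/H`. -/
theorem logDeriv_of_restFactorZ {f H : ℂ → ℂ} {j : ℕ} {Z : Multiset ℂ} (hZ : RestFactorZ f j Z H) {z : ℂ}
    (hz : iteratedDeriv j f z ≠ 0) :
    iteratedDeriv (j + 1) f z / iteratedDeriv j f z = (Z.map (fun q => (z - q)⁻¹)).sum + deriv H z / H z := by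
  have hF : iteratedDeriv j f = fun w => (Z.map (fun q => w - q)).prod * H w := funext hZ.2.1
  have hz' : (Z.map (fun q => z - q)).prod * H z ≠ 0 := by rw [← hZ.2.1 z]; exact hz
  rw [iteratedDeriv_succ, hF]
  exact logDeriv_prodLinear_mul Z hZ.1 hz'

/-- (K) monotonicity of the margin. -/
theorem linkMargin_mono {μ μ' : ℝ} (h : μ' ≤ μ) {f : ℂ → ℂ} {j : ℕ} {T : ℂ} (hL : LinkMargin μ f j T) : LinkMargin μ' f j T := by
  unfold LinkMargin at *
  linarith

/-- (K) GLUE to the tree's link-start currency (`RhW08.Lens1ArcSign.LinkStartLawQ`, ArcSignP :54, a THEOREM `linkStartLaw` ArcSignQ :204 under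
`NoTallerToucher` + simple top): `Im(f⁽ʲ⁺²⁾(T)/f⁽ʲ⁺¹⁾(T)) ≤ −1/Im T` is `LinkMargin 0`. -/
theorem linkMargin_zero_of_le {f : ℂ → ℂ} {j : ℕ} {T : ℂ} (hT : 0 < T.im)
    (h : (iteratedDeriv (j + 2) f T / iteratedDeriv (j + 1) f T).im ≤ -1 / T.im) : LinkMargin 0 f j T := by
  unfold LinkMargin
  have h1 : T.im * (iteratedDeriv (j + 2) f T / iteratedDeriv (j + 1) f T).im ≤ T.im * (-1 / T.im) :=
    mul_le_mul_of_nonneg_left h hT.le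
  rw [mul_div_assoc', mul_neg_one, neg_div, div_self hT.ne'] at h1
  linarith

/-- ★ (ii″) TOOTH–LIFT DICHOTOMY (OPEN law-candidate; instance `(θ, κ₁, μ, ρ) = (1/10, 2/5, 0, 5)`): frame → `StTrkDQ … j T` → `NoTallerToucher` →
θ-band partner `b` touching `T` → near tooth `t` → pole-aware rest factor `Z, H` (with multiplicity) containing the SUB-MULTISET `{T, T̄, b, b̄, t}` →
HEIGHT CAP `Im q ≤ Im T` on `Z` → BOX: `H ≠ 0` on `|Re z − Re T| ≤ ρ·Im T, |Im z| ≤ Im T` → `RVClassC κ₁` on the unpeeled rest → link margin `μ`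
⇒ a non-real zero of `f⁽ʲ⁺¹⁾` in `T`'s closed Jensen disc, or an NL event within `2·Im T` of `Re T` in range. -/
def ToothLiftDichotomyQ (θ κ₁ μ ρ : ℝ) : Prop :=
  ∀ (η : ℝ) (f : ℂ → ℂ) (x₀ s hmax R Hs : ℝ) (B : ℕ), EngineHyps5 2 η f x₀ s hmax R Hs B →
    ∀ (j : ℕ) (T b : ℂ) (t : ℝ) (Z : Multiset ℂ) (H : ℂ → ℂ),
    StTrkDQ η f x₀ s hmax R Hs B j T → NoTallerToucher f j T → (1 - θ) * T.im ≤ b.im → b.im ≤ T.im → |T.re - b.re| ≤ T.im + b.im →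
    |t - T.re| ≤ T.im / 2 → RestFactorZ f j Z H → ({T, conj T, b, conj b, (t : ℂ)} : Multiset ℂ) ≤ Z → (∀ q ∈ Z, q.im ≤ T.im) →
    (∀ q : ℂ, |q.re - T.re| ≤ ρ * T.im → |q.im| ≤ T.im → H q ≠ 0) → RVClassC κ₁ T H → LinkMargin μ f j T →
    (∃ w : ℂ, 0 < w.im ∧ iteratedDeriv (j + 1) f w = 0 ∧ NestedStep T w) ∨
    (∃ x : ℝ, |x - x₀| < ((j : ℝ) + 3) * R / 2 ∧ |x - T.re| ≤ 2 * T.im ∧ NLEventOf f j x)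

/-- ★ (iii″) LIFT DICHOTOMY (OPEN law-candidate; instance `(1/10, 2/5, 1/10, 5)`, the margin `μ` LOAD-BEARING): (ii″) without the tooth. -/
def LiftDichotomyQ (θ κ₁ μ ρ : ℝ) : Prop :=
  ∀ (η : ℝ) (f : ℂ → ℂ) (x₀ s hmax R Hs : ℝ) (B : ℕ), EngineHyps5 2 η f x₀ s hmax R Hs B →
    ∀ (j : ℕ) (T b : ℂ) (Z : Multiset ℂ) (H : ℂ → ℂ),
    StTrkDQ η f x₀ s hmax R Hs B j T → NoTallerToucher f j T → (1 - θ) * T.im ≤ b.im → b.im ≤ T.im → |T.re - b.re| ≤ T.im + b.im →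
    RestFactorZ f j Z H → ({T, conj T, b, conj b} : Multiset ℂ) ≤ Z → (∀ q ∈ Z, q.im ≤ T.im) →
    (∀ q : ℂ, |q.re - T.re| ≤ ρ * T.im → |q.im| ≤ T.im → H q ≠ 0) → RVClassC κ₁ T H → LinkMargin μ f j T →
    (∃ w : ℂ, 0 < w.im ∧ iteratedDeriv (j + 1) f w = 0 ∧ NestedStep T w) ∨
    (∃ x : ℝ, |x - x₀| < ((j : ℝ) + 3) * R / 2 ∧ |x - T.re| ≤ 2 * T.im ∧ NLEventOf f j x)

/-- (K) (iii″) implies (ii″) (forget the tooth: `{T, T̄, b, b̄} ≤ {T, T̄, b, b̄, t} ≤ Z`), at every parameter. -/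
theorem toothLiftDichotomy_of_lift {θ κ₁ μ ρ : ℝ} (h : LiftDichotomyQ θ κ₁ μ ρ) : ToothLiftDichotomyQ θ κ₁ μ ρ := by
  intro η f x₀ s hmax R Hs B hE j T b t Z H hT hN hb1 hb2 ht _ hZ hsub hcap hbox hRV hL
  refine h η f x₀ s hmax R Hs B hE j T b Z H hT hN hb1 hb2 ht hZ (le_trans ?_ hsub) hcap hbox hRV hL
  simp only [Multiset.insert_eq_cons]
  exact Multiset.cons_le_cons _ (Multiset.cons_le_cons _ (Multiset.cons_le_cons _ (Multiset.singleton_le.2 (Multiset.mem_cons_self _ _))))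

/-- (K) margin monotonicity of the laws: a law assuming margin `μ` gives the law assuming any larger margin. -/
theorem toothLiftDichotomy_mono {θ κ₁ μ μ' ρ : ℝ} (hμ : μ ≤ μ') (h : ToothLiftDichotomyQ θ κ₁ μ ρ) : ToothLiftDichotomyQ θ κ₁ μ' ρ :=
  fun η f x₀ s hmax R Hs B hE j T b t Z H hT hN hb1 hb2 ht hn hZ hsub hcap hbox hRV hL =>
    h η f x₀ s hmax R Hs B hE j T b t Z H hT hN hb1 hb2 ht hn hZ hsub hcap hbox hRV (linkMargin_mono hμ hL)

/-- ★ (K) DISPATCH of (ii″) inside 2′ (`hT` whole). The CONSUMER splits simple/multiple top BEFORE invoking: at a multiple top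
(`f⁽ʲ⁺¹⁾ T = 0`) use the TREE's `RhW08.NewtonDoor.succ_of_multiple hE hT h0` (`…R3NewtonDoor1` :131, in this file's closure; `LinkMargin` reads
`1/2 + μ ≤ 0` there by `x/0 = 0`, so the law is vacuous, never false); at a simple
top feed `Z` := the zeros of `f⁽ʲ⁾` with `|Re z − Re T| ≤ ρ·Im T, |Im z| ≤ Im T` with multiplicity, `H` := the extended quotient, the class, and the
margin (`μ = 0`: `linkMargin_zero_of_le hTim (linkStartLaw hE … hNT hs)` at a site importing ArcSignQ). -/
theorem succ_of_toothLiftDichotomy {θ κ₁ μ ρ : ℝ} (hN : ToothLiftDichotomyQ θ κ₁ μ ρ)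
    {η : ℝ} {f : ℂ → ℂ} {x₀ s hmax R Hs : ℝ} {B j : ℕ} {T b v : ℂ} {t : ℝ} {Z : Multiset ℂ} {H : ℂ → ℂ}
    (hE : EngineHyps5 2 η f x₀ s hmax R Hs B) (hT : StTrkDQ η f x₀ s hmax R Hs B j T) (hNT : NoTallerToucher f j T)
    (hb1 : (1 - θ) * T.im ≤ b.im) (hb2 : b.im ≤ T.im) (htouch : |T.re - b.re| ≤ T.im + b.im) (hnear : |t - T.re| ≤ T.im / 2)
    (hZ : RestFactorZ f j Z H) (hsub : ({T, conj T, b, conj b, (t : ℂ)} : Multiset ℂ) ≤ Z) (hcap : ∀ q ∈ Z, q.im ≤ T.im)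
    (hbox : ∀ q : ℂ, |q.re - T.re| ≤ ρ * T.im → |q.im| ≤ T.im → H q ≠ 0) (hRV : RVClassC κ₁ T H) (hL : LinkMargin μ f j T)
    (hnR : ¬ ReadyR2 η f x₀ s hmax R Hs B j v) : ∃ u : ℂ, StTrkDQ η f x₀ s hmax R Hs B (j + 1) u := by
  rcases hN η f x₀ s hmax R Hs B hE j T b t Z H hT hNT hb1 hb2 htouch hnear hZ hsub hcap hbox hRV hL with
    ⟨w, hwim, hw0, hn⟩ | ⟨x, hxr, -, hNL⟩
  · exact ⟨w, stTrkDQ_succ_of_nested hE hT hw0 hwim hn⟩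
  · exact (nl_branch_absurd hnR hxr hNL).elim

/-- ★ (K) DISPATCH of (iii″) inside 2′ (no tooth; same consumer-side simple/multiple split). -/
theorem succ_of_liftDichotomy {θ κ₁ μ ρ : ℝ} (hN : LiftDichotomyQ θ κ₁ μ ρ)
    {η : ℝ} {f : ℂ → ℂ} {x₀ s hmax R Hs : ℝ} {B j : ℕ} {T b v : ℂ} {Z : Multiset ℂ} {H : ℂ → ℂ}
    (hE : EngineHyps5 2 η f x₀ s hmax R Hs B) (hT : StTrkDQ η f x₀ s hmax R Hs B j T) (hNT : NoTallerToucher f j T)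
    (hb1 : (1 - θ) * T.im ≤ b.im) (hb2 : b.im ≤ T.im) (htouch : |T.re - b.re| ≤ T.im + b.im)
    (hZ : RestFactorZ f j Z H) (hsub : ({T, conj T, b, conj b} : Multiset ℂ) ≤ Z) (hcap : ∀ q ∈ Z, q.im ≤ T.im)
    (hbox : ∀ q : ℂ, |q.re - T.re| ≤ ρ * T.im → |q.im| ≤ T.im → H q ≠ 0) (hRV : RVClassC κ₁ T H) (hL : LinkMargin μ f j T)
    (hnR : ¬ ReadyR2 η f x₀ s hmax R Hs B j v) : ∃ u : ℂ, StTrkDQ η f x₀ s hmax R Hs B (j + 1) u := by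
  rcases hN η f x₀ s hmax R Hs B hE j T b Z H hT hNT hb1 hb2 htouch hZ hsub hcap hbox hRV hL with ⟨w, hwim, hw0, hn⟩ | ⟨x, hxr, -, hNL⟩
  · exact ⟨w, stTrkDQ_succ_of_nested hE hT hw0 hwim hn⟩
  · exact (nl_branch_absurd hnR hxr hNL).elim

/-! ## The signed-lift sign lemmas (C6 g46 scratch `umb/kappa/PairLift-C6-g46.lean` a46187d1584da925, statements and proofs VERBATIM; Mathlib only)
For `T = x_T + iy` and a peeled conjugate pair `q, q̄ = (x_T + X) ± iY` of multiplicity `m`, the pair's share of the signed lift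
`ℓ(T) = Im T · Im Σ m/(T − q)` is `m·y·((Y−y)/(X²+(Y−y)²) − (Y+y)/(X²+(Y+y)²))`, of the sign of `Y² − y² − X²`; it is `≤ 0` whenever `q` is NOT a
taller toucher (`Y ≤ y` — the HEIGHT CAP — or `y + Y < |X|` — `NoTallerToucher`); a real zero's share is `< 0`. -/

/-- (K, C6) the pair-lift identity. -/
theorem pairLift_identity (X y Y : ℝ) :
    (Y - y) * (X ^ 2 + (Y + y) ^ 2) - (Y + y) * (X ^ 2 + (Y - y) ^ 2) = 2 * y * (Y ^ 2 - y ^ 2 - X ^ 2) := by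
  ring

/-- (K, C6) a conjugate pair that is not a taller toucher never lifts. -/
theorem pairLift_nonpos {X y Y m : ℝ} (hy : 0 < y) (hY : 0 < Y) (hm : 0 ≤ m) (h : Y ≤ y ∨ y + Y < |X|) :
    m * y * ((Y - y) / (X ^ 2 + (Y - y) ^ 2) - (Y + y) / (X ^ 2 + (Y + y) ^ 2)) ≤ 0 := by
  have hd2 : 0 < X ^ 2 + (Y + y) ^ 2 := by positivity
  have hkey : Y ^ 2 ≤ X ^ 2 + y ^ 2 := by
    rcases h with h | h
    · nlinarith [sq_nonneg X]
    · have h1 : (y + Y) ^ 2 < X ^ 2 := by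
        calc (y + Y) ^ 2 < |X| ^ 2 := by gcongr
          _ = X ^ 2 := sq_abs X
      nlinarith
  have hbr : (Y - y) / (X ^ 2 + (Y - y) ^ 2) - (Y + y) / (X ^ 2 + (Y + y) ^ 2) ≤ 0 := by
    rcases eq_or_lt_of_le (show (0:ℝ) ≤ X ^ 2 + (Y - y) ^ 2 by positivity) with h0 | hd1
    · rw [← h0, div_zero, zero_sub, neg_nonpos]
      exact div_nonneg (by linarith) hd2.le
    · rw [div_sub_div _ _ hd1.ne' hd2.ne', div_nonpos_iff]
      right
      refine ⟨?_, by positivity⟩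
      have := pairLift_identity X y Y
      nlinarith
  have : 0 ≤ m * y := mul_nonneg hm hy.le
  calc m * y * _ ≤ m * y * 0 := by exact mul_le_mul_of_nonneg_left hbr this
    _ = 0 := by ring

/-- (K, C6) real zeros never lift: `Im T · Im (1/(T − t)) < 0` written out for `T = x + iy`, `t` real. -/
theorem toothLift_neg {x y t : ℝ} (hy : 0 < y) : y * (-(y) / ((x - t) ^ 2 + y ^ 2)) < 0 := by
  have : 0 < (x - t) ^ 2 + y ^ 2 := by positivity
  have : -(y) / ((x - t) ^ 2 + y ^ 2) < 0 := div_neg_of_neg_of_pos (by linarith) this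
  nlinarith

end RhW08.Lens1ToothNestUmbrella
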